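import Summits.Ventures.HodgeRepro2.T5TameCongruence
import Summits.Ventures.HodgeRepro2.T5DecompositionOrder

/-!
# T5FrobeniusGenerates — «D_p = ⟨Frob_p⟩»: the arithmetic Frobenius generates the decomposition group

Seat p3 of the blind cell `pub-hodge-repro2` (Tier-5 support column for sub-step N2 of
`route/TIER5.md`).  A kernel witness behind the words «`D_p = ⟨Frob_p⟩`» of row N2.2.5 of
`route/T5-N2-route-3.md`, with the Frobenius element taken from Mathlib (`arithFrobAt`: an element
`σ` of the Galois group with `σ x ≡ x^{|ℤ/p|} (mod P)` for every `x`).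

For a Galois number field `F/ℚ` and a prime `P` of `𝓞 F` above the rational prime `p`:

* `frob hp P : Gal(F/ℚ)` is an arithmetic Frobenius at `P`: `frob • x ≡ x ^ p (mod P)`
  (`mk_frob_smul`), and it lies in the decomposition group `D_P` (`frob_mem_stabilizer`);
* if `e(P ∣ p) = 1`: the order of `frob` in `D_P` is `f(P ∣ p)` (`orderOf_frob`) — its image in
  `Gal((𝓞 F ⧸ P)/(ℤ ⧸ p))` is the Frobenius automorphism `x ↦ x^p` of the finite field, of order
  `f`, and `|D_P| = f` (`T5DecompositionOrder`) — and `D_P = ⟨frob⟩` (`zpowers_frob_eq_top`).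

Declaration of README §8(d): this file uses an L-value-free non-vanishing device: NO.
-/

namespace Summit.Ventures.HodgeRepro2.T5FrobeniusGenerates

open NumberField Ideal
open scoped Pointwise

variable {F : Type*} [Field F] [NumberField F] [IsGalois ℚ F]
  {p : ℕ} (hp : p.Prime) (P : Ideal (𝓞 F)) [P.IsPrime] [P.LiesOver (span {(p : ℤ)})]

omit [IsGalois ℚ F] [P.IsPrime] in
include hp in
/-- The residue ring `𝓞 F ⧸ P` of a prime above `p` is finite. -/
theorem finite_quotient : Finite (𝓞 F ⧸ P) := by
  have hp0 : (p : ℤ) ≠ 0 := by exact_mod_cast hp.ne_zero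
  have hspan_bot : (span {(p : ℤ)}) ≠ ⊥ := by rw [Ne, span_singleton_eq_bot]; exact hp0
  exact Ring.HasFiniteQuotients.finiteQuotient (ne_bot_of_liesOver_of_ne_bot hspan_bot P)

/-- **The arithmetic Frobenius at `P`**: Mathlib's `arithFrobAt`, an element of `Gal(F/ℚ)` with
`frob • x ≡ x ^ p (mod P)` for every `x ∈ 𝓞 F` (`mk_frob_smul`). -/
noncomputable def frob : Gal(F/ℚ) :=
  haveI := T5TameCongruence.isGaloisGroup_gal (F := F)
  haveI := finite_quotient hp P
  arithFrobAt ℤ Gal(F/ℚ) P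

/-- `frob` is an arithmetic Frobenius at `P` in Mathlib's sense. -/
theorem isArithFrobAt_frob : IsArithFrobAt ℤ (frob hp P) P :=
  haveI := T5TameCongruence.isGaloisGroup_gal (F := F)
  haveI := finite_quotient hp P
  IsArithFrobAt.arithFrobAt ℤ Gal(F/ℚ) P

/-- `|ℤ ⧸ (p)| = p`. -/
theorem card_quotient_span : Nat.card (ℤ ⧸ span {(p : ℤ)}) = p := by
  rw [Nat.card_congr (Int.quotientSpanNatEquivZMod p).toEquiv, Nat.card_zmod]

include hp in
/-- **`Frob_P x ≡ x ^ p (mod P)`** for every algebraic integer `x`. -/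
theorem mk_frob_smul (x : 𝓞 F) :
    Ideal.Quotient.mk P (frob hp P • x) = (Ideal.Quotient.mk P x) ^ p := by
  haveI := T5TameCongruence.isGaloisGroup_gal (F := F)
  have h := (isArithFrobAt_frob hp P).mk_apply x
  rw [MulSemiringAction.toAlgHom_apply, ← P.over_def (span {(p : ℤ)}), card_quotient_span] at h
  exact h

/-- `Frob_P` lies in the decomposition group of `P`. -/
theorem frob_mem_stabilizer : frob hp P ∈ MulAction.stabilizer Gal(F/ℚ) P :=
  haveI := T5TameCongruence.isGaloisGroup_gal (F := F)
  (isArithFrobAt_frob hp P).mem_stabilizer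

/-- `Frob_P` as an element of the decomposition group. -/
noncomputable def frobD : MulAction.stabilizer Gal(F/ℚ) P := ⟨frob hp P, frob_mem_stabilizer hp P⟩

include hp in
/-- **The order of `Frob_P` in `D_P` is `f(P ∣ p)`** when `p` is unramified at `P`. -/
theorem orderOf_frobD (he : P.ramificationIdx ℤ = 1) : orderOf (frobD hp P) = P.inertiaDeg ℤ := by
  haveI := T5TameCongruence.isGaloisGroup_gal (F := F)
  have hp0 : (p : ℤ) ≠ 0 := by exact_mod_cast hp.ne_zero
  haveI hpI : (span {(p : ℤ)}).IsPrime :=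
    (span_singleton_prime hp0).mpr (Nat.prime_iff_prime_int.mp hp)
  have hspan_bot : (span {(p : ℤ)}) ≠ ⊥ := by rw [Ne, span_singleton_eq_bot]; exact hp0
  haveI : (span {(p : ℤ)}).IsMaximal := hpI.isMaximal hspan_bot
  have hPbot : P ≠ ⊥ := ne_bot_of_liesOver_of_ne_bot hspan_bot P
  haveI : P.IsMaximal := Ideal.IsPrime.isMaximal inferInstance hPbot
  haveI : Finite (𝓞 F ⧸ P) := finite_quotient hp P
  haveI : Finite (ℤ ⧸ span {(p : ℤ)}) := Ring.HasFiniteQuotients.finiteQuotient hspan_bot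
  letI : Field (ℤ ⧸ span {(p : ℤ)}) := Ideal.Quotient.field _
  letI : Field (𝓞 F ⧸ P) := Ideal.Quotient.field _
  letI : Fintype (ℤ ⧸ span {(p : ℤ)}) := Fintype.ofFinite _
  haveI : Module.Finite (ℤ ⧸ span {(p : ℤ)}) (𝓞 F ⧸ P) := Module.Finite.of_finite
  haveI : Algebra.IsAlgebraic (ℤ ⧸ span {(p : ℤ)}) (𝓞 F ⧸ P) := Algebra.IsAlgebraic.of_finite _ _
  -- the residue-field Frobenius and its order
  set fr := FiniteField.frobeniusAlgEquivOfAlgebraic (ℤ ⧸ span {(p : ℤ)}) (𝓞 F ⧸ P) with hfr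
  have hcardp : Fintype.card (ℤ ⧸ span {(p : ℤ)}) = p := by
    rw [Fintype.card_eq_nat_card, card_quotient_span]
  have hf : Module.finrank (ℤ ⧸ span {(p : ℤ)}) (𝓞 F ⧸ P) = P.inertiaDeg ℤ := by
    rw [← inertiaDeg'_algebraMap, inertiaDeg'_eq_inertiaDeg]
  have hord_fr : orderOf fr = P.inertiaDeg ℤ := by
    rw [hfr, FiniteField.orderOf_frobeniusAlgEquivOfAlgebraic, hf]
  -- the image of `frobD` under the stabiliser map is `fr`
  let φ := Ideal.Quotient.stabilizerHom P (span {(p : ℤ)}) Gal(F/ℚ)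
  have hφ : φ (frobD hp P) = fr := by
    apply AlgEquiv.ext
    intro y
    obtain ⟨x, rfl⟩ := Ideal.Quotient.mk_surjective y
    rw [hfr, FiniteField.coe_frobeniusAlgEquivOfAlgebraic, hcardp]
    exact mk_frob_smul hp P x
  -- `f ∣ orderOf frobD ∣ |D_P| = f`
  have h1 : P.inertiaDeg ℤ ∣ orderOf (frobD hp P) := by
    rw [← hord_fr, ← hφ]; exact orderOf_map_dvd φ (frobD hp P)
  have h2 : orderOf (frobD hp P) ∣ P.inertiaDeg ℤ := by
    have := orderOf_dvd_natCard (frobD hp P)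
    rwa [T5DecompositionOrder.card_stabilizer_eq_ramificationIdx_mul_inertiaDeg hp P, he,
      one_mul] at this
  exact Nat.dvd_antisymm h2 h1

include hp in
/-- **«D_P = ⟨Frob_P⟩»**: for `p` unramified at `P`, the decomposition group of `P` is the cyclic
group generated by the arithmetic Frobenius. -/
theorem zpowers_frobD_eq_top (he : P.ramificationIdx ℤ = 1) :
    Subgroup.zpowers (frobD hp P) = ⊤ := by
  apply Subgroup.eq_top_of_card_eq
  rw [Nat.card_zpowers, orderOf_frobD hp P he,
    T5DecompositionOrder.card_stabilizer_eq_ramificationIdx_mul_inertiaDeg hp P, he, one_mul]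

include hp in
/-- Every element of the decomposition group of an unramified `P` is an (integer) power of
`Frob_P`. -/
theorem exists_frob_zpow_eq (he : P.ramificationIdx ℤ = 1) (σ : Gal(F/ℚ))
    (hσ : σ ∈ MulAction.stabilizer Gal(F/ℚ) P) : ∃ n : ℤ, (frob hp P) ^ n = σ := by
  have hmem : (⟨σ, hσ⟩ : MulAction.stabilizer Gal(F/ℚ) P) ∈ Subgroup.zpowers (frobD hp P) := by
    rw [zpowers_frobD_eq_top hp P he]; exact Subgroup.mem_top _
  obtain ⟨n, hn⟩ := Subgroup.mem_zpowers_iff.mp hmem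
  refine ⟨n, ?_⟩
  have := congrArg Subtype.val hn
  simpa [frobD] using this

end Summit.Ventures.HodgeRepro2.T5FrobeniusGenerates
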